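import Summits.NavierStokesRegularity.NavierStokesRegularity.Theses.RellichScar
import Summits.NavierStokesRegularity.NavierStokesRegularity.Theorems.ScarRigidity.Negative.LogicAndLoadBearing
import Literature.Analysis.FluidPDE.TypeIAncientMild
import Literature.Analysis.FluidPDE.ParasiticSlabFlow
import Literature.Analysis.FluidPDE.NSGaldiDualityBounds
import Summits.NavierStokesRegularity.NavierStokesRegularity.Theorems.RellichScarScarRigidityCoulombField
import Summits.NavierStokesRegularity.NavierStokesRegularity.Theorems.RellichScarScarRigidityCoulombGreen
import Summits.NavierStokesRegularity.NavierStokesRegularity.Theorems.RellichScarScarRigidityCoulombPairing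
import Summits.NavierStokesRegularity.NavierStokesRegularity.Theorems.RellichScarScarRigidityLogConvexityODE
import Summits.NavierStokesRegularity.NavierStokesRegularity.Theorems.RellichScarScarRigidityLogConvexityPairing
import Summits.NavierStokesRegularity.NavierStokesRegularity.Theorems.RellichScarScarRigidityLogConvexityGreen
import Summits.NavierStokesRegularity.NavierStokesRegularity.Theorems.RellichScarScarRigidityLogConvexityDifference
import Summits.NavierStokesRegularity.NavierStokesRegularity.Theorems.RellichScarScarRigidityCoulombSlicePrep
import HarnessLib

/-!
# `ScarRigidity` — line `finite-energy-log-convexity`, stub `stub_coulombEnergyPackage`: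
# the Coulomb energy package of one time slice (crux stmt-NavierStokesRegularity-11717)

Helper file 12 of S4-E (`stub_coulombEnergyPackage`): one slice `t < 0`, `a = √(-t)`. For `C²`
divergence-free `V₁, V₂`, `C¹` pressures `Q₁, Q₂` with the apex bounds of the line and the twin majorant
`‖V₁ - V₂‖ ≤ K/(‖x‖+a)³` (`…CoulombSlicePrep`), put `w = V₁ - V₂`, `ψ = Γ ⋆ w`, `N₀ = -∫⟪w, ψ⟫`,
`b₀ = ∫‖w‖²`, `c₀ = Σᵢ∫‖∂ᵢw‖²`, `B = (w·∇)V₁ + (V₂·∇)w`, `p₀ = ∫⟪B, ψ⟫`, `q₀ = -∫⟪B, w⟫`,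
`F = Δw - ∇(Q₁ - Q₂) - B`. Then (`coulomb_slice`): `N₀ = Σᵢ∫‖∂ᵢψ‖² ≥ 0`; `∫⟪F, ψ⟫ = b₀ - p₀`,
`∫ 2⟪w, F⟫ = -2c₀ + 2q₀` (Green identities; the pressure drops out against `ψ` and `w`); the energy
inequality and frequency law at constant `C`, length `a` (`frequencyLaw_of_pairings` with the pairing
bounds for `φ = ψ`, `φ = w + lψ`, and `Σᵢ∫‖∂ᵢ(w + lψ)‖² = c₀ - 2lb₀ + l²N₀`); `N₀ = 0 ⇒ V₁ = V₂`.
-/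

noncomputable section

open Set Filter Function MeasureTheory Metric TopologicalSpace
open scoped Topology ENNReal NNReal RealInnerProductSpace
open Literature.Analysis.FluidPDE
open Summit.NavierStokesRegularity.NavierStokesRegularity.Theses.RellichScar
open Summit.NavierStokesRegularity.NavierStokesRegularity.Theorems.ScarRigidity.Negative

set_option linter.dupNamespace false

namespace Summit.NavierStokesRegularity.NavierStokesRegularity.Theorems.RellichScarScarRigidity

open Real
open scoped Laplacian

/-! ## The slice package -/

set_option maxHeartbeats 1000000 in
/-- **The Coulomb energy package of one time slice** (see the module docstring for the notation):
`N₀ ≥ 0`, `∫⟪F, ψ⟫ = b₀ - p₀`, `∫ 2⟪w, F⟫ = -2c₀ + 2q₀`, the energy inequality and the frequency law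
at the Type-I constant `C` and length `a`, and `N₀ = 0 ⇒ V₁ = V₂`. [folklore] -/
theorem coulomb_slice
    {V₁ V₂ : (EuclideanSpace ℝ (Fin 3)) → (EuclideanSpace ℝ (Fin 3))}
    {Q₁ Q₂ : (EuclideanSpace ℝ (Fin 3)) → ℝ} {c₁ c₂ C L₁ L₂ K a : ℝ}
    (hV₁ : ContDiff ℝ 2 V₁) (hV₂ : ContDiff ℝ 2 V₂) (hQ₁ : ContDiff ℝ 1 Q₁) (hQ₂ : ContDiff ℝ 1 Q₂)
    (hdiv₁ : VectorCalculus.IsDivFree V₁) (hdiv₂ : VectorCalculus.IsDivFree V₂) (hC : 0 ≤ C) (ha : 0 < a)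
    (hVb₁ : ∀ x, ‖V₁ x‖ ≤ C / (‖x‖ + a)) (hVb₂ : ∀ x, ‖V₂ x‖ ≤ C / (‖x‖ + a))
    (hg₁ : ∀ x, ‖fderiv ℝ V₁ x‖ ≤ L₁ / (‖x‖ + a) ^ 2)
    (hh₁ : ∀ x, ‖iteratedFDeriv ℝ 2 V₁ x‖ ≤ L₁ / (‖x‖ + a) ^ 3)
    (hq₁ : ∀ x, |Q₁ x - c₁| ≤ L₁ / (‖x‖ + a) ^ 2) (hgq₁ : ∀ x, ‖gradient Q₁ x‖ ≤ L₁ / (‖x‖ + a) ^ 3)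
    (hg₂ : ∀ x, ‖fderiv ℝ V₂ x‖ ≤ L₂ / (‖x‖ + a) ^ 2)
    (hh₂ : ∀ x, ‖iteratedFDeriv ℝ 2 V₂ x‖ ≤ L₂ / (‖x‖ + a) ^ 3)
    (hq₂ : ∀ x, |Q₂ x - c₂| ≤ L₂ / (‖x‖ + a) ^ 2) (hgq₂ : ∀ x, ‖gradient Q₂ x‖ ≤ L₂ / (‖x‖ + a) ^ 3)
    (hK : ∀ x, ‖V₁ x - V₂ x‖ ≤ K / (‖x‖ + a) ^ 3) :
    ∃ N₀ b₀ c₀ p₀ q₀ : ℝ,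
      N₀ = -∫ x, ⟪V₁ x - V₂ x, ∫ y, newtonKernel (x - y) • (V₁ y - V₂ y)⟫ ∧
      b₀ = ∫ x, ‖V₁ x - V₂ x‖ ^ 2 ∧
      0 ≤ N₀ ∧
      (∫ x, ⟪((Δ V₁) x - (Δ V₂) x) - (gradient Q₁ x - gradient Q₂ x) -
          (convect (fun y => V₁ y - V₂ y) V₁ x + convect V₂ (fun y => V₁ y - V₂ y) x),
          ∫ y, newtonKernel (x - y) • (V₁ y - V₂ y)⟫ = b₀ - p₀) ∧
      (∫ x, 2 * ⟪V₁ x - V₂ x, ((Δ V₁) x - (Δ V₂) x) - (gradient Q₁ x - gradient Q₂ x) -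
          (convect (fun y => V₁ y - V₂ y) V₁ x + convect V₂ (fun y => V₁ y - V₂ y) x)⟫ =
          -2 * c₀ + 2 * q₀) ∧
      (-(2 * b₀ + 4 * C / a * Real.sqrt (b₀ * N₀)) ≤ -2 * b₀ + 2 * p₀) ∧
      ((-2 * c₀ + 2 * q₀) * N₀ - b₀ * (-2 * b₀ + 2 * p₀) ≤ 2 * C ^ 2 / a ^ 2 * (b₀ * N₀)) ∧
      (N₀ = 0 → ∀ x, V₁ x = V₂ x) := by
  obtain ⟨m, hm0, hwbρ, hw1ρ, hw2ρ, hwb', hw1', hw2', hVb₁', hVb₂', hDV₁', hprb, hgradprb, hM₁, hM₂, hdivw,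
    hgradpr, hΔw⟩ := slice_decay hV₁ hV₂ hQ₁ hQ₂ hdiv₁ hdiv₂ hC ha hVb₁ hVb₂ hg₁ hh₁ hq₁ hgq₁ hg₂ hh₂ hq₂
    hgq₂ hK
  set w : (EuclideanSpace ℝ (Fin 3)) → (EuclideanSpace ℝ (Fin 3)) := fun x => V₁ x - V₂ x with hw_def
  set ψ : (EuclideanSpace ℝ (Fin 3)) → (EuclideanSpace ℝ (Fin 3)) :=
    fun x => ∫ y, newtonKernel (x - y) • w y with hψ_def
  set e := EuclideanSpace.basisFun (Fin 3) ℝ with he_def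
  set pr : (EuclideanSpace ℝ (Fin 3)) → ℝ := fun x => (Q₁ x - c₁) - (Q₂ x - c₂) with hpr_def
  set Bf : (EuclideanSpace ℝ (Fin 3)) → (EuclideanSpace ℝ (Fin 3)) :=
    fun x => convect w V₁ x + convect V₂ w x with hB_def
  have he1 : ∀ i, ‖e i‖ = 1 := fun i => e.norm_eq_one i
  have hwC2 : ContDiff ℝ 2 w := hV₁.sub hV₂
  have hwC1 : ContDiff ℝ 1 w := hwC2.of_le one_le_two
  have hV₁1 : ContDiff ℝ 1 V₁ := hV₁.of_le one_le_two
  have hV₂1 : ContDiff ℝ 1 V₂ := hV₂.of_le one_le_two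
  have hprC1 : ContDiff ℝ 1 pr := (hQ₁.sub contDiff_const).sub (hQ₂.sub contDiff_const)
  have hL : 0 ≤ |L₁| + |L₂| := by positivity
  have hwbρ : ∀ y, ‖w y‖ ≤ |K| * ((‖y‖ + a) ^ 3)⁻¹ := hwbρ
  have hprb : ∀ x, |pr x| ≤ (|L₁| + |L₂|) * m ^ 2 * (1 + ‖x‖) ^ (-(2 : ℝ)) := hprb
  have hwb' : ∀ x, ‖w x‖ ≤ |K| * m ^ 3 * (1 + ‖x‖) ^ (-(3 : ℝ)) := hwb'
  have hA0 : 0 ≤ |K| * m ^ 3 := by positivity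
  have hA10 : 0 ≤ (|L₁| + |L₂|) * m ^ 2 := by positivity
  have hA20 : 0 ≤ (|L₁| + |L₂|) * m ^ 3 := by positivity
  have hCv0 : 0 ≤ C * m := by positivity
  have hB10 : 0 ≤ |L₁| * m ^ 2 := by positivity
  -- ### the potential
  have hψC2 : ContDiff ℝ 2 ψ := contDiff_two_newtonPotential hwC2 ha (abs_nonneg K) hwbρ
  have hψC1 : ContDiff ℝ 1 ψ := hψC2.of_le one_le_two
  have hΔψ : ∀ x, (Δ ψ) x = w x := laplacian_newtonPotential hwC2 ha (abs_nonneg K) hwbρ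
  have hFB : ∃ P₀ P₁ P₂ : ℝ, 0 ≤ P₀ ∧ 0 ≤ P₁ ∧ 0 ≤ P₂ ∧
      (∀ x : EuclideanSpace ℝ (Fin 3), x ≠ 0 → ‖ψ x‖ ≤ P₀ * ‖x‖ ^ (-(3 / 4 : ℝ))) ∧
      (∀ x : EuclideanSpace ℝ (Fin 3), ‖fderiv ℝ ψ x‖ ≤ P₁ * (1 + ‖x‖) ^ (-(7 / 4 : ℝ))) ∧
      (∀ (x : EuclideanSpace ℝ (Fin 3)) (i : Fin 3),
        ‖fderiv ℝ (fun y => fderiv ℝ ψ y (e i)) x (e i)‖ ≤ P₂ * (1 + ‖x‖) ^ (-(5 / 2 : ℝ))) :=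
    exists_newtonPotential_field_bounds hwC2 ha (abs_nonneg K) hL hL hwbρ hw1ρ hw2ρ
  obtain ⟨P₀, P₁, P₂, hP₀, hP₁, hP₂, hψ0, hψ1, hψ2⟩ := hFB
  have hdivψ : VectorCalculus.IsDivFree ψ := isDivFree_newtonPotential hwC2 hdivw ha (abs_nonneg K) hwbρ
  clear_value w ψ pr Bf
  -- ### Green identities and pairing integrability
  obtain ⟨I1, I2, I3, I4, G2, G1, G3⟩ := green_identities_of_decay hwC2 hψC2 hΔψ hA0 hA10 hA20 hP₁ hP₂
    hwb' hw1' hw2' hψ0 hψ1 hψ2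
  have PI := fun k l => pairing_integrability hV₁1 hV₂1 hwC1 hψC1 hCv0 hB10 hA0 hA10 hP₀ hP₁ hVb₁' hVb₂'
    hDV₁' hwb' hw1' hψ0 hψ1 k l
  obtain ⟨Jψ0, Jψ1, Jψ2, Jψ0', Jψ1', Jψ2', Jw2, JDψ⟩ := PI 0 1
  simp only [zero_smul, one_smul, zero_add] at Jψ0 Jψ1 Jψ2 Jψ0' Jψ1' Jψ2' JDψ
  have hcw : Continuous w := hwC1.continuous
  have hcψ : Continuous ψ := hψC1.continuous
  have hcDwi : ∀ i, Continuous fun x => fderiv ℝ w x (e i) := fun i =>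
    (hwC1.continuous_fderiv one_ne_zero).clm_apply continuous_const
  have hcD2wi : ∀ i, Continuous fun x => fderiv ℝ (fun y => fderiv ℝ w y (e i)) x (e i) := fun i =>
    ((((hwC2.fderiv_right (m := 1) le_rfl).clm_apply contDiff_const).continuous_fderiv
      one_ne_zero).clm_apply continuous_const)
  have hcΔw : Continuous (Δ w) := Literature.Analysis.FluidPDE.continuous_laplacian hwC2
  have hcgrad : Continuous (gradient pr) := continuous_gradient_of_contDiff hprC1
  have hcpr : Continuous pr := hprC1.continuous
  have hx1 : ∀ x : EuclideanSpace ℝ (Fin 3), (1 + ‖x‖)⁻¹ = (1 + ‖x‖) ^ (-(1 : ℝ)) := fun x =>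
    (Real.rpow_neg_one _).symm
  -- ### more integrable products
  have hΔwb : ∀ x, ‖(Δ w) x‖ ≤ 3 * ((|L₁| + |L₂|) * m ^ 3) * (1 + ‖x‖) ^ (-(3 : ℝ)) := by
    intro x
    rw [laplacian_eq_sum_fderiv_fderiv e hwC2 x]
    calc ‖∑ i, fderiv ℝ (fun y => fderiv ℝ w y (e i)) x (e i)‖
        ≤ ∑ i, ‖fderiv ℝ (fun y => fderiv ℝ w y (e i)) x (e i)‖ := norm_sum_le _ _
      _ ≤ ∑ _i : Fin 3, (|L₁| + |L₂|) * m ^ 3 * (1 + ‖x‖) ^ (-(3 : ℝ)) := Finset.sum_le_sum fun i _ => hw2' x i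
      _ = 3 * ((|L₁| + |L₂|) * m ^ 3) * (1 + ‖x‖) ^ (-(3 : ℝ)) := by
          rw [Finset.sum_const, Finset.card_fin]; simp [nsmul_eq_mul]; ring
  have IΔψ : Integrable (fun x => ⟪(Δ w) x, ψ x⟫) volume := by
    refine integrable_of_le_one_add_norm_rpow_mul_rpow (hcΔw.inner hcψ).aestronglyMeasurable
      (M := 3 * ((|L₁| + |L₂|) * m ^ 3) * P₀) (r := 3) (s := 3 / 4) (by norm_num) (by norm_num)
      (by norm_num) fun x hx => ?_
    have hnn : 0 ≤ 3 * ((|L₁| + |L₂|) * m ^ 3) * (1 + ‖x‖) ^ (-(3 : ℝ)) := by positivity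
    have h1 : ‖⟪(Δ w) x, ψ x⟫‖ ≤ ‖(Δ w) x‖ * ‖ψ x‖ := norm_inner_le_norm _ _
    have h2 : ‖(Δ w) x‖ * ‖ψ x‖ ≤ (3 * ((|L₁| + |L₂|) * m ^ 3) * (1 + ‖x‖) ^ (-(3 : ℝ))) * (P₀ * ‖x‖ ^ (-(3 / 4 : ℝ))) :=
      mul_le_mul (hΔwb x) (hψ0 x hx) (norm_nonneg _) hnn
    refine h1.trans (h2.trans (le_of_eq ?_))
    ring
  have Iψpr : Integrable (fun x => ⟪ψ x, gradient pr x⟫) volume := by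
    refine integrable_of_le_one_add_norm_rpow_mul_rpow (hcψ.inner hcgrad).aestronglyMeasurable
      (M := P₀ * ((|L₁| + |L₂|) * m ^ 3)) (r := 3) (s := 3 / 4) (by norm_num) (by norm_num)
      (by norm_num) fun x hx => ?_
    calc ‖⟪ψ x, gradient pr x⟫‖ ≤ P₀ * ‖x‖ ^ (-(3 / 4 : ℝ)) * ((|L₁| + |L₂|) * m ^ 3 * (1 + ‖x‖) ^ (-(3 : ℝ))) :=
          norm_inner_le_of_le (hψ0 x hx) (hgradprb x) (by positivity)
      _ = _ := by ring
  have Wψpr : Integrable (fun x => (1 + ‖x‖)⁻¹ * (|pr x| * ‖ψ x‖)) volume := by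
    refine integrable_of_le_one_add_norm_rpow_mul_rpow
      (((continuous_const.add continuous_norm).inv₀ fun x => (by positivity : (0:ℝ) < 1 + ‖x‖).ne').mul
        (hcpr.abs.mul hcψ.norm)).aestronglyMeasurable
      (M := (|L₁| + |L₂|) * m ^ 2 * P₀) (r := 3) (s := 3 / 4) (by norm_num) (by norm_num) (by norm_num)
      fun x hx => ?_
    rw [Real.norm_of_nonneg (by positivity), hx1]
    calc (1 + ‖x‖) ^ (-(1 : ℝ)) * (|pr x| * ‖ψ x‖)
        ≤ (1 + ‖x‖) ^ (-(1 : ℝ)) * ((|L₁| + |L₂|) * m ^ 2 * (1 + ‖x‖) ^ (-(2 : ℝ)) * (P₀ * ‖x‖ ^ (-(3 / 4 : ℝ)))) :=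
          mul_le_mul_of_nonneg_left (mul_le_mul (hprb x) (hψ0 x hx) (norm_nonneg _) (by positivity))
            (by positivity)
      _ = (|L₁| + |L₂|) * m ^ 2 * P₀ * (((1 + ‖x‖) ^ (-(1 : ℝ)) * (1 + ‖x‖) ^ (-(2 : ℝ))) * ‖x‖ ^ (-(3 / 4 : ℝ))) := by
          ring
      _ = _ := by rw [one_add_norm_rpow_mul]; norm_num
  have Iwpr : Integrable (fun x => ⟪w x, gradient pr x⟫) volume := by
    refine integrable_of_le_one_add_norm_rpow (hcw.inner hcgrad).aestronglyMeasurable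
      (M := |K| * m ^ 3 * ((|L₁| + |L₂|) * m ^ 3)) (r := 6) (by norm_num) fun x => ?_
    calc ‖⟪w x, gradient pr x⟫‖ ≤ |K| * m ^ 3 * (1 + ‖x‖) ^ (-(3 : ℝ)) * ((|L₁| + |L₂|) * m ^ 3 * (1 + ‖x‖) ^ (-(3 : ℝ))) :=
          norm_inner_le_of_le (hwb' x) (hgradprb x) (by positivity)
      _ = |K| * m ^ 3 * ((|L₁| + |L₂|) * m ^ 3) * ((1 + ‖x‖) ^ (-(3 : ℝ)) * (1 + ‖x‖) ^ (-(3 : ℝ))) := by ring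
      _ = _ := by rw [one_add_norm_rpow_mul]; norm_num
  have Ipw : Integrable (fun x => pr x • w x) volume := by
    refine integrable_of_le_one_add_norm_rpow (f := fun x => pr x • w x) (hcpr.smul hcw).aestronglyMeasurable
      (M := (|L₁| + |L₂|) * m ^ 2 * (|K| * m ^ 3)) (r := 5) (by norm_num) fun x => ?_
    rw [norm_smul, Real.norm_eq_abs]
    calc |pr x| * ‖w x‖ ≤ (|L₁| + |L₂|) * m ^ 2 * (1 + ‖x‖) ^ (-(2 : ℝ)) * (|K| * m ^ 3 * (1 + ‖x‖) ^ (-(3 : ℝ))) :=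
          mul_le_mul (hprb x) (hwb' x) (norm_nonneg _) (by positivity)
      _ = (|L₁| + |L₂|) * m ^ 2 * (|K| * m ^ 3) * ((1 + ‖x‖) ^ (-(2 : ℝ)) * (1 + ‖x‖) ^ (-(3 : ℝ))) := by ring
      _ = _ := by rw [one_add_norm_rpow_mul]; norm_num
  -- `⟪w, Δw⟫` and the hypotheses of the dissipation identity
  have IwΔ : Integrable (fun x => ⟪(Δ w) x, w x⟫) volume := by
    refine integrable_of_le_one_add_norm_rpow (hcΔw.inner hcw).aestronglyMeasurable
      (M := 3 * ((|L₁| + |L₂|) * m ^ 3) * (|K| * m ^ 3)) (r := 6) (by norm_num) fun x => ?_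
    have hnn : 0 ≤ 3 * ((|L₁| + |L₂|) * m ^ 3) * (1 + ‖x‖) ^ (-(3 : ℝ)) := by positivity
    have h1 : ‖⟪(Δ w) x, w x⟫‖ ≤ ‖(Δ w) x‖ * ‖w x‖ := norm_inner_le_norm _ _
    have h2 : ‖(Δ w) x‖ * ‖w x‖ ≤
        (3 * ((|L₁| + |L₂|) * m ^ 3) * (1 + ‖x‖) ^ (-(3 : ℝ))) * (|K| * m ^ 3 * (1 + ‖x‖) ^ (-(3 : ℝ))) :=
      mul_le_mul (hΔwb x) (hwb' x) (norm_nonneg _) hnn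
    refine h1.trans (h2.trans (le_of_eq ?_))
    calc (3 * ((|L₁| + |L₂|) * m ^ 3) * (1 + ‖x‖) ^ (-(3 : ℝ))) * (|K| * m ^ 3 * (1 + ‖x‖) ^ (-(3 : ℝ)))
        = 3 * ((|L₁| + |L₂|) * m ^ 3) * (|K| * m ^ 3) * ((1 + ‖x‖) ^ (-(3 : ℝ)) * (1 + ‖x‖) ^ (-(3 : ℝ))) := by ring
      _ = _ := by rw [one_add_norm_rpow_mul]; norm_num
  have Hww : ∀ i, Integrable (fun x => ⟪fderiv ℝ w x (e i), w x⟫) volume := by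
    intro i
    refine integrable_of_le_one_add_norm_rpow ((hcDwi i).inner hcw).aestronglyMeasurable
      (M := (|L₁| + |L₂|) * m ^ 2 * (|K| * m ^ 3)) (r := 5) (by norm_num) fun x => ?_
    calc ‖⟪fderiv ℝ w x (e i), w x⟫‖ ≤ (|L₁| + |L₂|) * m ^ 2 * (1 + ‖x‖) ^ (-(2 : ℝ)) * (|K| * m ^ 3 * (1 + ‖x‖) ^ (-(3 : ℝ))) :=
          norm_inner_le_of_le ((norm_apply_le_opNorm_of_unit _ (he1 i)).trans (hw1' x)) (hwb' x) (by positivity)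
      _ = (|L₁| + |L₂|) * m ^ 2 * (|K| * m ^ 3) * ((1 + ‖x‖) ^ (-(2 : ℝ)) * (1 + ‖x‖) ^ (-(3 : ℝ))) := by ring
      _ = _ := by rw [one_add_norm_rpow_mul]; norm_num
  have Kww : ∀ i, Integrable (fun x => ⟪fderiv ℝ (fun y => fderiv ℝ w y (e i)) x (e i), w x⟫) volume := by
    intro i
    refine integrable_of_le_one_add_norm_rpow ((hcD2wi i).inner hcw).aestronglyMeasurable
      (M := (|L₁| + |L₂|) * m ^ 3 * (|K| * m ^ 3)) (r := 6) (by norm_num) fun x => ?_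
    calc ‖⟪fderiv ℝ (fun y => fderiv ℝ w y (e i)) x (e i), w x⟫‖
        ≤ (|L₁| + |L₂|) * m ^ 3 * (1 + ‖x‖) ^ (-(3 : ℝ)) * (|K| * m ^ 3 * (1 + ‖x‖) ^ (-(3 : ℝ))) :=
          norm_inner_le_of_le (hw2' x i) (hwb' x) (by positivity)
      _ = (|L₁| + |L₂|) * m ^ 3 * (|K| * m ^ 3) * ((1 + ‖x‖) ^ (-(3 : ℝ)) * (1 + ‖x‖) ^ (-(3 : ℝ))) := by ring
      _ = _ := by rw [one_add_norm_rpow_mul]; norm_num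
  have IBψ' : Integrable (fun x => ⟪convect w V₁ x, ψ x⟫ + ⟪convect V₂ w x, ψ x⟫) volume := Jψ1.add Jψ1'
  have IBψ : Integrable (fun x => ⟪Bf x, ψ x⟫) volume :=
    IBψ'.congr (Eventually.of_forall fun x => by simp only [hB_def, inner_add_left])
  obtain ⟨-, Jw1, -, -, Jw1', -, -, -⟩ := PI 1 0
  simp only [zero_smul, one_smul, add_zero] at Jw1 Jw1'
  have IBw' : Integrable (fun x => ⟪convect w V₁ x, w x⟫ + ⟪convect V₂ w x, w x⟫) volume := Jw1.add Jw1'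
  have IBw : Integrable (fun x => ⟪Bf x, w x⟫) volume :=
    IBw'.congr (Eventually.of_forall fun x => by simp only [hB_def, inner_add_left])
  -- ### the numbers of the package
  set N₀ : ℝ := -∫ x, ⟪w x, ψ x⟫ with hN₀_def
  set b₀ : ℝ := ∫ x, ‖w x‖ ^ 2 with hb₀_def
  set c₀ : ℝ := ∑ i, ∫ x, ‖fderiv ℝ w x (e i)‖ ^ 2 with hc₀_def
  set p₀ : ℝ := ∫ x, ⟪Bf x, ψ x⟫ with hp₀_def
  set q₀ : ℝ := -∫ x, ⟪Bf x, w x⟫ with hq₀_def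
  have hN₀sum : N₀ = ∑ i, ∫ x, ‖fderiv ℝ ψ x (e i)‖ ^ 2 := G2.symm
  have hN₀0 : 0 ≤ N₀ := by
    rw [hN₀sum]; exact Finset.sum_nonneg fun i _ => integral_nonneg fun x => sq_nonneg _
  have hb₀0 : 0 ≤ b₀ := integral_nonneg fun x => sq_nonneg _
  have hpress : ∫ x, ⟪gradient pr x, ψ x⟫ = 0 :=
    integral_inner_gradient_eq_zero_of_weighted hprC1 hψC1 hdivψ Wψpr Iψpr
  have hpressw : ∫ x, ⟪gradient pr x, w x⟫ = 0 :=
    integral_inner_gradient_eq_zero_of_isDivFree hprC1 hwC1 hdivw Ipw Iwpr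
  have hdiss : ∫ x, ⟪(Δ w) x, w x⟫ = -c₀ := integral_inner_laplacian_self_eq_neg e hwC2 Hww I4 Kww
  have hF : ∀ x, ((Δ V₁) x - (Δ V₂) x) - (gradient Q₁ x - gradient Q₂ x) - Bf x =
      (Δ w) x - gradient pr x - Bf x := fun x => by rw [hΔw x, hgradpr x]
  have Iprψ : Integrable (fun x => ⟪gradient pr x, ψ x⟫) volume :=
    Iψpr.congr (Eventually.of_forall fun x => real_inner_comm _ _)
  have hS2 : ∫ x, ⟪((Δ V₁) x - (Δ V₂) x) - (gradient Q₁ x - gradient Q₂ x) - Bf x, ψ x⟫ = b₀ - p₀ := by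
    simp_rw [hF, inner_sub_left]
    have h12 : Integrable (fun x => ⟪(Δ w) x, ψ x⟫ - ⟪gradient pr x, ψ x⟫) volume := IΔψ.sub Iprψ
    rw [integral_sub h12 IBψ, integral_sub IΔψ Iprψ, G3, hpress, sub_zero]
  have hS3 : ∫ x, 2 * ⟪w x, ((Δ V₁) x - (Δ V₂) x) - (gradient Q₁ x - gradient Q₂ x) - Bf x⟫ =
      -2 * c₀ + 2 * q₀ := by
    simp_rw [hF, inner_sub_right]
    have IwΔ' : Integrable (fun x => ⟪w x, (Δ w) x⟫) volume :=
      IwΔ.congr (Eventually.of_forall fun x => real_inner_comm _ _)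
    have IwB : Integrable (fun x => ⟪w x, Bf x⟫) volume :=
      IBw.congr (Eventually.of_forall fun x => real_inner_comm _ _)
    have h12 : Integrable (fun x => ⟪w x, (Δ w) x⟫ - ⟪w x, gradient pr x⟫) volume := IwΔ'.sub Iwpr
    rw [integral_const_mul, integral_sub h12 IwB, integral_sub IwΔ' Iwpr]
    have e1 : ∫ x, ⟪w x, (Δ w) x⟫ = -c₀ := by
      rw [← hdiss]; exact integral_congr_ae (Eventually.of_forall fun x => real_inner_comm _ _)
    have e2 : ∫ x, ⟪w x, gradient pr x⟫ = 0 := by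
      rw [← hpressw]; exact integral_congr_ae (Eventually.of_forall fun x => real_inner_comm _ _)
    have e3 : ∫ x, ⟪w x, Bf x⟫ = -q₀ := by
      rw [hq₀_def, neg_neg]; exact integral_congr_ae (Eventually.of_forall fun x => real_inner_comm _ _)
    rw [e1, e2, e3]; ring
  have hMpos : 0 ≤ C / a := div_nonneg hC ha.le
  have hp : |p₀| ≤ 2 * (C / a) * Real.sqrt b₀ * Real.sqrt N₀ := by
    have key := abs_integral_inner_linConvect_le hV₁1 hV₂1 hwC1 hψC1 hdivw hdiv₂ hM₁ hM₂
      Jψ0 Jψ1 Jψ2 Jψ0' Jψ1' Jψ2' Jw2 JDψ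
    have hle : ∫ x, ‖fderiv ℝ ψ x‖ ^ 2 ≤ N₀ := by
      rw [hN₀sum, ← integral_finsetSum _ fun i _ => I2 i]
      exact integral_mono JDψ (integrable_finsetSum _ fun i _ => I2 i) fun x =>
        opNorm_sq_le_sum_sq_basisFun _
    have hp0eq : p₀ = ∫ x, ⟪convect w V₁ x + convect V₂ w x, ψ x⟫ := by rw [hp₀_def, hB_def]
    rw [hp0eq]
    calc |∫ x, ⟪convect w V₁ x + convect V₂ w x, ψ x⟫|
        ≤ 2 * (C / a) * Real.sqrt (∫ x, ‖w x‖ ^ 2) * Real.sqrt (∫ x, ‖fderiv ℝ ψ x‖ ^ 2) := key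
      _ ≤ 2 * (C / a) * Real.sqrt b₀ * Real.sqrt N₀ :=
          mul_le_mul_of_nonneg_left (Real.sqrt_le_sqrt hle) (by positivity)
  have hq : ∀ l : ℝ, 0 ≤ c₀ - 2 * l * b₀ + l ^ 2 * N₀ ∧
      |q₀ - l * p₀| ≤ 2 * (C / a) * Real.sqrt b₀ * Real.sqrt (c₀ - 2 * l * b₀ + l ^ 2 * N₀) := by
    intro l
    have hφC1 : ContDiff ℝ 1 fun y => w y + l • ψ y := hwC1.add (hψC1.const_smul l)
    have hDφi : ∀ x i, fderiv ℝ (fun y => w y + l • ψ y) x (e i) = fderiv ℝ w x (e i) + l • fderiv ℝ ψ x (e i) := by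
      intro x i
      have h : HasFDerivAt (fun y => w y + l • ψ y) (fderiv ℝ w x + l • fderiv ℝ ψ x) x :=
        (((hwC1.differentiable one_ne_zero) x).hasFDerivAt).add
          ((((hψC1.differentiable one_ne_zero) x).hasFDerivAt).const_smul l)
      rw [h.fderiv]
      rfl
    have alg : ∀ u v : EuclideanSpace ℝ (Fin 3), ‖u + l • v‖ ^ 2 = ‖u‖ ^ 2 + 2 * l * ⟪v, u⟫ + l ^ 2 * ‖v‖ ^ 2 := by
      intro u v
      rw [norm_add_sq_real, norm_smul, real_inner_smul_right, Real.norm_eq_abs, mul_pow, sq_abs,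
        real_inner_comm]
      ring
    have hexp : ∀ x i, ‖fderiv ℝ (fun y => w y + l • ψ y) x (e i)‖ ^ 2 =
        ‖fderiv ℝ w x (e i)‖ ^ 2 + 2 * l * ⟪fderiv ℝ ψ x (e i), fderiv ℝ w x (e i)⟫ +
          l ^ 2 * ‖fderiv ℝ ψ x (e i)‖ ^ 2 := fun x i =>
      (congrArg (fun v : EuclideanSpace ℝ (Fin 3) => ‖v‖ ^ 2) (hDφi x i)).trans (alg _ _)
    have hi : ∀ i, (∫ x, (‖fderiv ℝ w x (e i)‖ ^ 2 + 2 * l * ⟪fderiv ℝ ψ x (e i), fderiv ℝ w x (e i)⟫ +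
        l ^ 2 * ‖fderiv ℝ ψ x (e i)‖ ^ 2)) =
        (∫ x, ‖fderiv ℝ w x (e i)‖ ^ 2) + 2 * l * (∫ x, ⟪fderiv ℝ ψ x (e i), fderiv ℝ w x (e i)⟫) +
          l ^ 2 * ∫ x, ‖fderiv ℝ ψ x (e i)‖ ^ 2 := by
      intro i
      have J1 : Integrable (fun x => 2 * l * ⟪fderiv ℝ ψ x (e i), fderiv ℝ w x (e i)⟫) volume :=
        (I3 i).const_mul _
      have J2 : Integrable (fun x => l ^ 2 * ‖fderiv ℝ ψ x (e i)‖ ^ 2) volume := (I2 i).const_mul _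
      have J12 : Integrable (fun x => ‖fderiv ℝ w x (e i)‖ ^ 2 +
          2 * l * ⟪fderiv ℝ ψ x (e i), fderiv ℝ w x (e i)⟫) volume := (I4 i).add J1
      rw [integral_add J12 J2, integral_add (I4 i) J1, integral_const_mul, integral_const_mul]
    have hDl : (∑ i, ∫ x, ‖fderiv ℝ (fun y => w y + l • ψ y) x (e i)‖ ^ 2) = c₀ - 2 * l * b₀ + l ^ 2 * N₀ := by
      calc (∑ i, ∫ x, ‖fderiv ℝ (fun y => w y + l • ψ y) x (e i)‖ ^ 2)
          = ∑ i, ∫ x, (‖fderiv ℝ w x (e i)‖ ^ 2 + 2 * l * ⟪fderiv ℝ ψ x (e i), fderiv ℝ w x (e i)⟫ +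
              l ^ 2 * ‖fderiv ℝ ψ x (e i)‖ ^ 2) :=
            Finset.sum_congr rfl fun i _ => integral_congr_ae (Eventually.of_forall fun x => hexp x i)
        _ = ∑ i, ((∫ x, ‖fderiv ℝ w x (e i)‖ ^ 2) + 2 * l * (∫ x, ⟪fderiv ℝ ψ x (e i), fderiv ℝ w x (e i)⟫) +
              l ^ 2 * ∫ x, ‖fderiv ℝ ψ x (e i)‖ ^ 2) := Finset.sum_congr rfl fun i _ => hi i
        _ = c₀ - 2 * l * b₀ + l ^ 2 * N₀ := by
            rw [Finset.sum_add_distrib, Finset.sum_add_distrib, ← Finset.mul_sum, ← Finset.mul_sum, G1,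
              ← hN₀sum, hc₀_def, hb₀_def]
            ring
    have hDl0 : 0 ≤ c₀ - 2 * l * b₀ + l ^ 2 * N₀ := by
      rw [← hDl]; exact Finset.sum_nonneg fun i _ => integral_nonneg fun x => sq_nonneg _
    refine ⟨hDl0, ?_⟩
    obtain ⟨L0, L1, L2, L0', L1', L2', -, LD⟩ := PI 1 l
    simp only [one_smul] at L0 L1 L2 L0' L1' L2' LD
    have key := abs_integral_inner_linConvect_le hV₁1 hV₂1 hwC1 hφC1 hdivw hdiv₂ hM₁ hM₂
      L0 L1 L2 L0' L1' L2' Jw2 LD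
    have hlin : ∫ x, ⟪Bf x, w x + l • ψ x⟫ = (∫ x, ⟪Bf x, w x⟫) + l * ∫ x, ⟪Bf x, ψ x⟫ := by
      simp_rw [inner_add_right, real_inner_smul_right]
      rw [integral_add IBw (IBψ.const_mul l), integral_const_mul]
    have hql : q₀ - l * p₀ = -∫ x, ⟪Bf x, w x + l • ψ x⟫ := by rw [hlin, hq₀_def, hp₀_def]; ring
    have hID : Integrable (fun x => ∑ i, ‖fderiv ℝ (fun y => w y + l • ψ y) x (e i)‖ ^ 2) volume := by
      refine integrable_finsetSum _ fun i _ => ?_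
      simp_rw [hDφi]
      have : (fun x => ‖fderiv ℝ w x (e i) + l • fderiv ℝ ψ x (e i)‖ ^ 2) =
          fun x => ‖fderiv ℝ w x (e i)‖ ^ 2 + 2 * l * ⟪fderiv ℝ ψ x (e i), fderiv ℝ w x (e i)⟫ +
            l ^ 2 * ‖fderiv ℝ ψ x (e i)‖ ^ 2 := by
        funext x
        rw [norm_add_sq_real, norm_smul, real_inner_smul_right, Real.norm_eq_abs, mul_pow, sq_abs,
          real_inner_comm]
        ring
      rw [this]
      have J1 : Integrable (fun x => 2 * l * ⟪fderiv ℝ ψ x (e i), fderiv ℝ w x (e i)⟫) volume :=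
        (I3 i).const_mul _
      have J2 : Integrable (fun x => l ^ 2 * ‖fderiv ℝ ψ x (e i)‖ ^ 2) volume := (I2 i).const_mul _
      exact ((I4 i).add J1).add J2
    have hIi : ∀ i, Integrable (fun x => ‖fderiv ℝ (fun y => w y + l • ψ y) x (e i)‖ ^ 2) volume := by
      intro i
      refine (LD.mono' (((hφC1.continuous_fderiv one_ne_zero).clm_apply continuous_const).norm.pow 2
        |>.aestronglyMeasurable) (Eventually.of_forall fun x => ?_))
      rw [Real.norm_of_nonneg (sq_nonneg _)]
      exact pow_le_pow_left₀ (norm_nonneg _) (norm_apply_le_opNorm_of_unit _ (he1 i)) 2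
    have hle : ∫ x, ‖fderiv ℝ (fun y => w y + l • ψ y) x‖ ^ 2 ≤ c₀ - 2 * l * b₀ + l ^ 2 * N₀ := by
      rw [← hDl, ← integral_finsetSum _ fun i _ => hIi i]
      exact integral_mono LD (integrable_finsetSum _ fun i _ => hIi i) fun x => opNorm_sq_le_sum_sq_basisFun _
    rw [hql, abs_neg]
    simp only [hB_def]
    calc |∫ x, ⟪convect w V₁ x + convect V₂ w x, w x + l • ψ x⟫|
        ≤ 2 * (C / a) * Real.sqrt (∫ x, ‖w x‖ ^ 2) * Real.sqrt (∫ x, ‖fderiv ℝ (fun y => w y + l • ψ y) x‖ ^ 2) :=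
          key
      _ ≤ 2 * (C / a) * Real.sqrt b₀ * Real.sqrt (c₀ - 2 * l * b₀ + l ^ 2 * N₀) :=
          mul_le_mul_of_nonneg_left (Real.sqrt_le_sqrt hle) (by positivity)
  have hgη : 2 * (C / a) * Real.sqrt b₀ ≤ 2 * C / a * Real.sqrt b₀ := le_of_eq (by ring)
  obtain ⟨h5, h6⟩ := frequencyLaw_of_pairings hN₀0 hb₀0 (by positivity) hp hq hgη
  have hker : N₀ = 0 → ∀ x, V₁ x = V₂ x := by
    intro hN x
    have hb : b₀ = 0 := by
      refine eq_zero_of_forall_sub_nonneg (c := c₀) hb₀0 fun l => ?_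
      have h := (hq l).1
      rw [hN, mul_zero, add_zero] at h
      exact h
    have hw0 := eq_zero_of_integral_norm_sq_eq_zero hcw Jw2 hb x
    rw [show w x = V₁ x - V₂ x from congr_fun hw_def x] at hw0
    exact sub_eq_zero.1 hw0
  have h5' : -(2 * b₀ + 4 * C / a * Real.sqrt (b₀ * N₀)) ≤ -2 * b₀ + 2 * p₀ := by
    have e4 : 2 * (2 * C / a) * Real.sqrt (b₀ * N₀) = 4 * C / a * Real.sqrt (b₀ * N₀) := by ring
    linarith [h5, e4]
  have h6' : (-2 * c₀ + 2 * q₀) * N₀ - b₀ * (-2 * b₀ + 2 * p₀) ≤ 2 * C ^ 2 / a ^ 2 * (b₀ * N₀) := by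
    have e5 : (2 * C / a) ^ 2 / 2 * (b₀ * N₀) = 2 * C ^ 2 / a ^ 2 * (b₀ * N₀) := by ring
    linarith [h6, e5]
  subst hB_def
  subst hψ_def
  subst hw_def
  exact ⟨N₀, b₀, c₀, p₀, q₀, rfl, rfl, hN₀0, hS2, hS3, h5', h6', hker⟩

/-! ## Registered sub-goal (helper stub of `stub_coulombEnergyPackage`) -/

/-- **Registered helper stub `stub_coulombSliceExtinctionAlgebra`** (crux stmt-NavierStokesRegularity-11717,
line `finite-energy-log-convexity`, helper of S4-E): the algebraic step `(∀ l, 0 ≤ c - 2lb) ⇒ b = 0` of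
`N₀ = 0 ⇒ w = 0`, as registered. [folklore] -/
theorem stub_coulombSliceExtinctionAlgebra :
    ∀ (b c : ℝ), 0 ≤ b → (∀ l : ℝ, 0 ≤ c - 2 * l * b) → b = 0 :=
  fun _b _c hb h => eq_zero_of_forall_sub_nonneg hb h

end Summit.NavierStokesRegularity.NavierStokesRegularity.Theorems.RellichScarScarRigidity

end
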